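import Summits.AnomalousDissipation.AnomalousDissipation.Theorems.MomentParityQuarticGateQuadRange
import Summits.AnomalousDissipation.AnomalousDissipation.Theorems.MomentParityQuarticGateLambdaPositivity

/-!
# Order-3 surgery for `MomentParity.QuarticGate` (stmt-AnomalousDissipation-11464), helper IV:
# polynomial bookkeeping for transporting tests to a band basis ("Transport")

Support file for the stub `stub_order3Surgery` of the line `recession-cone` (S5). Torus-free
algebra of polynomial observables `p(u) = P((u,g₁),…,(u,gₘ))` and their differentials
`∇p(u) = Σⱼ ∂ⱼP(…) gⱼ` when the test fields are expanded in a basis, `gⱼ = Σᵢ Gⱼᵢ bᵢ`: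

* `eval_bind₁_linear`, `sum_eval_pderiv_smul_eq_of_eq_sum` — `p` and `∇p` are unchanged when
  `(g, P)` is replaced by `(b, P ∘ G)` (`P ∘ G = bind₁ (j ↦ Σᵢ C Gⱼᵢ · Xᵢ) P`; chain rule
  `pderiv_bind₁`);
* `totalDegree_bind₁_linear_le` — the substitution does not raise the total degree;
* `sum_eval_pderiv_sum_smul` — `∇` is linear in `P`;
* `pderiv_eq_C_of_totalDegree_le_one` — tests of degree `≤ 1` have constant differentials;
* `rieszFunctional_smul`, `rieszFunctional_sub`, `degree_le_of_mem_support_sub_homogeneousComponent`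
  — Riesz-functional bookkeeping used to split a row polynomial into its cubic top and the rest.
-/

-- `Summit.<Summit>.<Problem>` is the tree's mandated summit-side namespace (CONVENTIONS §2); for this
-- single-conjunct summit the two coincide, so the duplicate is deliberate.
set_option linter.dupNamespace false

namespace Summit.AnomalousDissipation.AnomalousDissipation.Theorems.MomentParityQuarticGate

open scoped BigOperators
open MvPolynomial Literature.MeasureTheory.Moments

/-! ## Linear substitutions `Xⱼ ↦ Σᵢ Gⱼᵢ Xᵢ` -/

/-- Evaluating `P ∘ G` at `x` is evaluating `P` at `G x`. [folklore] -/
theorem eval_bind₁_linear {m n : ℕ} (G : Fin m → Fin n → ℝ) (x : Fin n → ℝ)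
    (P : MvPolynomial (Fin m) ℝ) :
    eval x (bind₁ (fun j => ∑ i, C (G j i) * (X i : MvPolynomial (Fin n) ℝ)) P) =
      eval (fun j => ∑ i, G j i * x i) P := by
  show eval₂Hom (RingHom.id ℝ) x (bind₁ _ P) = eval₂Hom (RingHom.id ℝ) _ P
  rw [eval₂Hom_bind₁]
  congr 2
  funext j
  simp

/-- A linear substitution does not raise the total degree. [folklore] -/
theorem totalDegree_bind₁_linear_le {m n : ℕ} (G : Fin m → Fin n → ℝ) (P : MvPolynomial (Fin m) ℝ) :
    (bind₁ (fun j => ∑ i, C (G j i) * (X i : MvPolynomial (Fin n) ℝ)) P).totalDegree ≤ P.totalDegree := by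
  classical
  have hlin : ∀ j, (∑ i, C (G j i) * (X i : MvPolynomial (Fin n) ℝ)).totalDegree ≤ 1 := fun j =>
    totalDegree_finsetSum_le fun i _ => (totalDegree_mul _ _).trans (by
      rw [totalDegree_C, totalDegree_X, zero_add])
  conv_lhs => rw [MvPolynomial.as_sum P]
  rw [map_sum]
  refine totalDegree_finsetSum_le fun d hd => ?_
  rw [bind₁_monomial]
  refine (totalDegree_mul _ _).trans ?_
  rw [totalDegree_C, zero_add]
  refine (totalDegree_finsetProd _ _).trans ?_
  refine (Finset.sum_le_sum fun j _ => (totalDegree_pow _ _).trans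
    (Nat.mul_le_mul_left _ (hlin j))).trans ?_
  simp_rw [mul_one]
  exact le_totalDegree hd

/-- The derivative of a linear form `Σᵢ' cᵢ' Xᵢ'` in `Xᵢ` is the constant `cᵢ`. [folklore] -/
theorem pderiv_sum_C_mul_X {n : ℕ} (c : Fin n → ℝ) (i : Fin n) :
    pderiv i (∑ i', C (c i') * (X i' : MvPolynomial (Fin n) ℝ)) = C (c i) := by
  classical
  rw [map_sum]
  simp_rw [pderiv_C_mul, pderiv_X, Pi.single_apply, mul_ite, mul_one, mul_zero]
  rw [Finset.sum_ite_eq' Finset.univ i, if_pos (Finset.mem_univ i)]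

/-- **Transport of the differential.** If `gⱼ = Σᵢ Gⱼᵢ bᵢ` (as vectors of any real vector space)
and the coordinates transform accordingly, `cg j = Σᵢ Gⱼᵢ cb i`, then
`Σⱼ ∂ⱼP(cg) gⱼ = Σᵢ ∂ᵢ(P ∘ G)(cb) bᵢ`. [folklore] -/
theorem sum_eval_pderiv_smul_eq_of_eq_sum :
    ∀ {m n : ℕ} {V : Type} [AddCommGroup V] [Module ℝ V] (G : Fin m → Fin n → ℝ) (gv : Fin m → V)
      (bv : Fin n → V), (∀ j, gv j = ∑ i, G j i • bv i) → ∀ (cb : Fin n → ℝ)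
      (P : MvPolynomial (Fin m) ℝ), ∑ j, MvPolynomial.eval (fun j => ∑ i, G j i * cb i)
      (MvPolynomial.pderiv j P) • gv j = ∑ i, MvPolynomial.eval cb (MvPolynomial.pderiv i
      (MvPolynomial.bind₁ (fun j => ∑ i, MvPolynomial.C (G j i) * (MvPolynomial.X i :
      MvPolynomial (Fin n) ℝ)) P)) • bv i := by
  intro m n V _ _ G gv bv hg cb P
  simp_rw [pderiv_bind₁, pderiv_sum_C_mul_X, map_sum, map_mul, eval_C, eval_bind₁_linear, hg,
    Finset.smul_sum, Finset.sum_smul, smul_smul]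
  rw [Finset.sum_comm]

/-- **Transport of the observable.** `P((u,g)) = (P ∘ G)((u,b))`. [folklore] -/
theorem eval_eq_eval_bind₁_of_eq_sum {m n : ℕ} (G : Fin m → Fin n → ℝ) (cg : Fin m → ℝ)
    (cb : Fin n → ℝ) (hc : ∀ j, cg j = ∑ i, G j i * cb i) (P : MvPolynomial (Fin m) ℝ) :
    eval cg P = eval cb (bind₁ (fun j => ∑ i, C (G j i) * (X i : MvPolynomial (Fin n) ℝ)) P) := by
  rw [eval_bind₁_linear, show cg = fun j => ∑ i, G j i * cb i from funext hc]

/-! ## Linearity of the differential in `P`, constant differentials -/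

/-- `∇` is linear in the polynomial: `Σⱼ ∂ⱼ(Σₐ wₐ Pₐ)(c) gⱼ = Σₐ wₐ Σⱼ ∂ⱼPₐ(c) gⱼ`. [folklore] -/
theorem sum_eval_pderiv_sum_smul {m : ℕ} {V : Type*} [AddCommGroup V] [Module ℝ V] {ι : Type*}
    (s : Finset ι) (w : ι → ℝ) (P : ι → MvPolynomial (Fin m) ℝ) (c : Fin m → ℝ) (gv : Fin m → V) :
    ∑ j, eval c (pderiv j (∑ a ∈ s, w a • P a)) • gv j =
      ∑ a ∈ s, w a • ∑ j, eval c (pderiv j (P a)) • gv j := by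
  simp_rw [map_sum, Derivation.map_smul, smul_eval, Finset.sum_smul, Finset.smul_sum, smul_smul]
  rw [Finset.sum_comm]

/-- A polynomial of total degree `≤ 1` has constant partial derivatives. [folklore] -/
theorem pderiv_eq_C_of_totalDegree_le_one {m : ℕ} (P : MvPolynomial (Fin m) ℝ)
    (hP : P.totalDegree ≤ 1) (i : Fin m) : pderiv i P = C (P.coeff (Finsupp.single i 1)) := by
  classical
  refine MvPolynomial.ext _ _ fun d => ?_
  rw [coeff_pderiv, coeff_C]
  by_cases hd : d = 0
  · subst hd
    simp
  · rw [if_neg (Ne.symm hd), coeff_eq_zero_of_totalDegree_lt, zero_mul]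
    have hdeg : (d + Finsupp.single i 1).degree = d.degree + 1 := by
      rw [map_add, Finsupp.degree_single]
    have hd1 : 1 ≤ d.degree :=
      Nat.one_le_iff_ne_zero.mpr fun h => hd ((Finsupp.degree_eq_zero_iff d).mp h)
    have key : P.totalDegree < (d + Finsupp.single i 1).degree := by
      rw [hdeg]
      omega
    rwa [Finsupp.degree_apply] at key

/-! ## Riesz-functional bookkeeping -/

/-- `L_y(c p) = c L_y(p)`. [folklore] -/
theorem rieszFunctional_smul {n : ℕ} (y : (Fin n →₀ ℕ) → ℝ) (c : ℝ) (p : MvPolynomial (Fin n) ℝ) :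
    rieszFunctional y (c • p) = c * rieszFunctional y p := by
  rw [rieszFunctional_eq_sum_of_subset y (c • p) support_smul]
  unfold rieszFunctional
  rw [Finset.mul_sum]
  refine Finset.sum_congr rfl fun α _ => ?_
  rw [coeff_smul, smul_eq_mul, mul_assoc]

/-- `L_y(p - q) = L_y(p) - L_y(q)`. [folklore] -/
theorem rieszFunctional_sub {n : ℕ} (y : (Fin n →₀ ℕ) → ℝ) (p q : MvPolynomial (Fin n) ℝ) :
    rieszFunctional y (p - q) = rieszFunctional y p - rieszFunctional y q := by
  have h := rieszFunctional_add y (p - q) q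
  rw [sub_add_cancel] at h
  linarith

/-- `L_y(Σₐ wₐ pₐ) = Σₐ wₐ L_y(pₐ)`. [folklore] -/
theorem rieszFunctional_sum_smul {n : ℕ} (y : (Fin n →₀ ℕ) → ℝ) {ι : Type*} (s : Finset ι)
    (w : ι → ℝ) (p : ι → MvPolynomial (Fin n) ℝ) :
    rieszFunctional y (∑ a ∈ s, w a • p a) = ∑ a ∈ s, w a * rieszFunctional y (p a) := by
  rw [rieszFunctional_finsetSum]
  simp_rw [rieszFunctional_smul]

/-- Removing the degree-`k` component of a polynomial of degree `≤ k` leaves degree `< k`: every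
exponent in the support of `Q - Q_k` has degree `≤ k - 1`. [folklore] -/
theorem degree_le_of_mem_support_sub_homogeneousComponent {n k : ℕ} (Q : MvPolynomial (Fin n) ℝ)
    (hQ : Q.totalDegree ≤ k) {β : Fin n →₀ ℕ} (hβ : β ∈ (Q - homogeneousComponent k Q).support) :
    β.degree + 1 ≤ k := by
  classical
  rw [mem_support_iff, coeff_sub, coeff_homogeneousComponent] at hβ
  split_ifs at hβ with h
  · exact absurd (sub_self _) hβ
  · rw [sub_zero] at hβ
    have := (finsupp_degree_eq_sum β).trans_le ((le_totalDegree (mem_support_iff.mpr hβ)).trans hQ)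
    omega

/-- The Riesz functional of `Q - Q_k` only sees entries of degree `< k`. [folklore] -/
theorem rieszFunctional_sub_homogeneousComponent_congr {n k : ℕ} {y y' : (Fin n →₀ ℕ) → ℝ}
    (h : ∀ α : Fin n →₀ ℕ, α.degree + 1 ≤ k → y α = y' α) (Q : MvPolynomial (Fin n) ℝ)
    (hQ : Q.totalDegree ≤ k) :
    rieszFunctional y (Q - homogeneousComponent k Q) = rieszFunctional y' (Q - homogeneousComponent k Q) := by
  unfold rieszFunctional
  refine Finset.sum_congr rfl fun β hβ => ?_
  rw [h β (degree_le_of_mem_support_sub_homogeneousComponent Q hQ hβ)]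

/-- The Riesz functional of the degree-`k` component is the degree-`k` part of the sum. [folklore] -/
theorem rieszFunctional_homogeneousComponent {n k : ℕ} (y : (Fin n →₀ ℕ) → ℝ)
    (Q : MvPolynomial (Fin n) ℝ) :
    rieszFunctional y (homogeneousComponent k Q) =
      ∑ β ∈ Q.support, if β.degree = k then Q.coeff β * y β else 0 := by
  classical
  have hsub : (homogeneousComponent k Q).support ⊆ Q.support := by
    rw [support_homogeneousComponent]
    exact Finset.filter_subset _ _
  rw [rieszFunctional_eq_sum_of_subset y _ hsub]
  refine Finset.sum_congr rfl fun β _ => ?_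
  rw [coeff_homogeneousComponent]
  split_ifs <;> simp

end Summit.AnomalousDissipation.AnomalousDissipation.Theorems.MomentParityQuarticGate
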